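import Summits.HodgeConjecture.HodgeConjecture.Theorems.MarkmanPartnerTransportK3Sq2OneCycleIsometries
import Summits.HodgeConjecture.HodgeConjecture.Theorems.MarkmanPartnerTransportK3Sq2TypeHodgeOfCycleInducedGenerator
import Summits.HodgeConjecture.HodgeConjecture.Theorems.MarkmanPartnerTransportIsometrySpannedThirdOfThreeFacts

/-!
# Route MarkmanPartnerTransport · crux #5 `LowPicardRealMultiplication` (stmt-HodgeConjecture-19653) BY NAME,
# reduced to ONE CYCLE

Composition of the `X`-side one-cycle engine (`…K3Sq2OneCycle`), the exclusion of its CM alternative under the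
crux's own hypothesis `¬ SpannedByIsometries` (`…K3Sq2OneCycleIsometries`: complex multiplication forces
`SpannedByIsometries`), and the `X`-side F4 `hodgeConjectureFor_of_cycleInducedGenerator` (prover g7):

* `lowPicardRealMultiplication_of_oneCycleFifth` — **the route declaration `LowPicardRealMultiplication` ITSELF**
  (crux #5, `ρ(X) ≤ 3`, `¬ SpannedByIsometries`), modulo {Verbitsky–Guan, O'Grady, `QInvAlgebraic`}, from the
  ONE-CYCLE CLAUSE (degree form): every marked smooth projective `K3^{[2]}`-type `X` with `ρ(X) ≤ 3` whose
  transcendental Hodge endomorphisms are not spanned by isometries carries ONE algebraic class `Z ∈ A⁴(X × X)`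
  whose action `[Z]_*` on `H²(X)` (rational, type-preserving) has eigenvalue `ev` on the symplectic form with
  `deg minpoly_ℚ(ev) = k` and `k · j · m + ρ(X) ≠ 23` (`j ≥ 2`, `m ≥ 3`) — at `ρ(X) ∈ {1, 2}` any IRRATIONAL `ev`
  will do (`lowPicardRealMultiplication_of_oneCycleFifth_prime`: prime form, the arithmetic side condition
  `d · m + ρ(X) = 23 ⇒ d` prime being automatic there and reading "`[E:ℚ] ≠ 4`" at `ρ(X) = 3`);
* `…_of_charlesMarkman` — the same modulo {Verbitsky–Guan, O'Grady, Charles–Markman 2013};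
* `hodgeConjectureFor_of_oneCycle_of_isometrySpannedThird` / `…_of_four_facts` — at EVERY Picard rank (with the
  arithmetic side condition), one such cycle gives HC⁴(X) with NO CM clause: the CM alternative is absorbed by item
  #3 `IsometrySpannedThird` (tree theorem `isometrySpannedThird_of_three_facts`, modulo {Verbitsky–Guan,
  Charles–Markman, Markman 2024}).

So crux #5 now reads, by name: «on a projective `K3^{[2]}`-type `X` with `ρ(X) ≤ 3` and genuine real
multiplication, some algebraic self-correspondence acts on `H^{2,0}(X)` by a generator of the RM field» — one
cycle, not a spanning family. CONDITIONAL on the displayed named facts; no definition, no sorry. Prover seat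
hodge-nonav-19652-p1 (gen 8), `--supports stmt-HodgeConjecture-19653`. Nothing here proves the crux or HC.

References: E. Markman, Compos. Math. 160 (2024) Thm. 1.1; M. Varesco, Math. Z. 305 (2023) §2; B. van Geemen,
Michigan Math. J. 56 (2008) Lemma 3.2; Yu. Zarhin, J. reine angew. Math. 341 (1983) Thm. 1.5.1, 1.6.
-/

noncomputable section

set_option linter.dupNamespace false

open Module CategoryTheory MonoidalCategory Polynomial
open Literature.AlgebraicTopology.SingularHomology Literature.Geometry.Kaehler
open Literature.AlgebraicGeometry Literature.AlgebraicGeometry.Motives Literature.AlgebraicGeometry.HodgeTheory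
open Literature.AlgebraicGeometry.Hyperkaehler Literature.AlgebraicGeometry.Surfaces
open Summit.HodgeConjecture.HodgeConjecture.Theorems.NikulinTwinTransport

namespace Summit.HodgeConjecture.HodgeConjecture.Theorems.MarkmanPartnerTransport.PartnerLattice

/-- `MarkedK3Sq[X, φ, P, z]`: VERBATIM the `let MarkedK3Sq := …` binder of the route declarations of
MarkmanPartnerTransport (clauses (m1)–(m6)). Local notation only. -/
local notation3 (prettyPrint := false) "MarkedK3Sq[" X ", " φ ", " P ", " z "]" =>
  (((IsIntegralClass P ∧ ∀ Q : complexBetti X (2 * 4), IsIntegralClass Q → ∃ n : ℤ, Q = n • P) ∧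
    (∀ c : complexBetti X 2, IsIntegralClass c ↔ ∃ v : K3HilbertIndex → ℤ, φ c = fun i => (v i : ℂ)) ∧
    (∀ a : complexBetti X 2, cupPowTwo a 4 = ((3 : ℂ) * (k3HilbertForm 2 (φ a) (φ a)) ^ 2) • P) ∧
    (IsOfHodgeType 4 X 2 2 0 (LinearEquiv.symm φ z) ∧
      ∀ τ : complexBetti X 2, IsOfHodgeType 4 X 2 2 0 τ → ∃ t : ℂ, τ = t • LinearEquiv.symm φ z) ∧
    (∀ c : complexBetti X 2, IsOfHodgeType 4 X 2 1 1 c ↔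
      (k3HilbertForm 2 (φ c) z = 0 ∧ k3HilbertForm 2 (φ c) (star z) = 0)) ∧
    (k3HilbertForm 2 z z = 0 ∧ 0 < (k3HilbertForm 2 (star z) z).re)))

/-- `SpIso[X, φ]`: VERBATIM the `let SpannedByIsometries := …` binder of the route declarations (with
`IsBBFTransc` unfolded). Local notation only. -/
local notation3 (prettyPrint := false) "SpIso[" X ", " φ "]" =>
  (∀ f : complexBetti X 2 →ₗ[ℂ] complexBetti X 2, (∀ y, IsRationalClass y → IsRationalClass (f y)) →
    (∀ (i j : ℕ) y, IsOfHodgeType 4 X 2 i j y → IsOfHodgeType 4 X 2 i j (f y)) →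
    (∀ d : complexBetti X 2, d ∈ algebraicClasses X 1 → f d = 0) →
    (∀ y : complexBetti X 2, ∀ d : complexBetti X 2, d ∈ algebraicClasses X 1 →
      k3HilbertForm 2 (φ (f y)) (φ d) = 0) →
    ∃ (k : ℕ) (c : Fin k → ℚ) (g : Fin k → (complexBetti X 2 →ₗ[ℂ] complexBetti X 2)),
      (∀ i, Function.Bijective (g i) ∧ (∀ y, IsRationalClass y → IsRationalClass (g i y)) ∧
        (∀ (a b : ℕ) y, IsOfHodgeType 4 X 2 a b y → IsOfHodgeType 4 X 2 a b (g i y)) ∧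
        (∀ a b, k3HilbertForm 2 (φ (g i a)) (φ (g i b)) = k3HilbertForm 2 (φ a) (φ b))) ∧
      ∀ y : complexBetti X 2, (∀ d : complexBetti X 2, d ∈ algebraicClasses X 1 →
        k3HilbertForm 2 (φ y) (φ d) = 0) → f y = ∑ i : Fin k, ((c i : ℂ) • g i y))

/-! ### Crux #5 by name from the one-cycle clause -/

/-- **`LowPicardRealMultiplication` BY NAME from the one-cycle clause, degree form** (module docstring): for every
marked smooth projective `K3^{[2]}`-type `X` with `ρ(X) ≤ 3` and `¬ SpannedByIsometries`, ONE cycle-induced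
rational type-preserving endomorphism `t = [Z]_*` with `t σ = ev σ`, `deg minpoly_ℚ(ev) = k`, `k·j·m + ρ(X) ≠ 23`
(`j ≥ 2`, `m ≥ 3`) — then the route declaration holds, modulo {Verbitsky–Guan, O'Grady, `QInvAlgebraic`}: the
engine's CM alternative would force `SpannedByIsometries` (`spannedByIsometries_of_cm`), so `End_Hdg(T(X)_ℚ) =
ℚ[t|_T]` and the `X`-side F4 concludes. [cite: Markman2024, §1.1 Thm. 1.1] [cite: Varesco2023, §2 (p. 8)]
[cite: Vangeemen2008, Lemma 3.2] [cite: Zarhin1983HodgeGroupsK3, Thm. 1.5.1 and Thm. 1.6] -/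
theorem lowPicardRealMultiplication_of_oneCycleFifth
    (hV : VerbitskyGuan_cohomology_K3HilbertSquareType) (hO : OGrady2008_dualBBFClass_algebraic) (hQ : QInvAlgebraic)
    (hOne : ∀ (X : SchemeOver ℂ) (hX : IsSmoothProjective 4 X), IsOfK3HilbertSquareType X →
      ∀ (φ : complexBetti X 2 ≃ₗ[ℂ] (K3HilbertIndex → ℂ)) (P : complexBetti X (2 * 4)) (z : K3HilbertIndex → ℂ),
      MarkedK3Sq[X, φ, P, z] → ¬ SpIso[X, φ] → Module.finrank ℂ ↥(algebraicClasses X 1) ≤ 3 →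
      ∃ (k : ℕ) (t : complexBetti X 2 →ₗ[ℂ] complexBetti X 2),
        (∀ j m : ℕ, 2 ≤ j → 3 ≤ m → k * j * m + Module.finrank ℂ ↥(algebraicClasses X 1) ≠ 23) ∧
        (∀ y, IsRationalClass y → IsRationalClass (t y)) ∧
        (∀ (a b : ℕ) y, IsOfHodgeType 4 X 2 a b y → IsOfHodgeType 4 X 2 a b (t y)) ∧
        (∃ Z ∈ algebraicClasses (X ⊗ X) 4, ∀ y : complexBetti X 2,
          t y = corrAction complexOrientationFamily hX hX (rfl : 2 + 2 * 4 = 2 + 2 * 4) Z y) ∧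
        ∃ ev : ℂ, t (φ.symm z) = ev • φ.symm z ∧ (minpoly ℚ ev).natDegree = k) :
    Summit.HodgeConjecture.HodgeConjecture.Theses.MarkmanPartnerTransport.LowPicardRealMultiplication := by
  intro X hX hK φ P z hM hsp hρ
  obtain ⟨k, t, hk, ht_rat, ht_typ, ht_cyc, ev, ht_ev, hdeg⟩ := hOne X hX hK φ P z hM hsp hρ
  rcases generatedBy_or_cm_of_eigenvalue_natDegree hX hM hk t ht_rat ht_typ ht_ev hdeg with
    hgen | ⟨-, Ψ, hΨrat, hΨ11, μ, hμ, hΨσ⟩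
  · exact hodgeConjectureFor_of_cycleInducedGenerator hV hO hQ hX hK hM t ht_rat ht_typ ht_cyc hgen
  · exact absurd (spannedByIsometries_of_cm hX hM Ψ hΨrat hΨ11 hΨσ hμ) hsp

/-- **`LowPicardRealMultiplication` BY NAME from the one-cycle clause, prime form**: ONE cycle-induced rational
type-preserving `t = [Z]_*` with an IRRATIONAL eigenvalue on the symplectic form, together with the arithmetic
side condition "`d · m + ρ(X) = 23`, `d ≥ 2`, `m ≥ 3` ⇒ `d` prime" (AUTOMATIC at `ρ(X) ∈ {1, 2}`: `22 = 2·11`,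
`21 = 3·7`; at `ρ(X) = 3` it says `[E:ℚ] ≠ 4`) — modulo {Verbitsky–Guan, O'Grady, `QInvAlgebraic`}.
[cite: Markman2024, §1.1 Thm. 1.1] [cite: Varesco2023, §2 (p. 8)] [cite: Vangeemen2008, Lemma 3.2]
[cite: Zarhin1983HodgeGroupsK3, Thm. 1.5.1 and Thm. 1.6] -/
theorem lowPicardRealMultiplication_of_oneCycleFifth_prime
    (hV : VerbitskyGuan_cohomology_K3HilbertSquareType) (hO : OGrady2008_dualBBFClass_algebraic) (hQ : QInvAlgebraic)
    (hOne : ∀ (X : SchemeOver ℂ) (hX : IsSmoothProjective 4 X), IsOfK3HilbertSquareType X →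
      ∀ (φ : complexBetti X 2 ≃ₗ[ℂ] (K3HilbertIndex → ℂ)) (P : complexBetti X (2 * 4)) (z : K3HilbertIndex → ℂ),
      MarkedK3Sq[X, φ, P, z] → ¬ SpIso[X, φ] → Module.finrank ℂ ↥(algebraicClasses X 1) ≤ 3 →
      (∀ d m : ℕ, 2 ≤ d → 3 ≤ m → d * m + Module.finrank ℂ ↥(algebraicClasses X 1) = 23 → d.Prime) ∧
      ∃ t : complexBetti X 2 →ₗ[ℂ] complexBetti X 2,
        (∀ y, IsRationalClass y → IsRationalClass (t y)) ∧
        (∀ (a b : ℕ) y, IsOfHodgeType 4 X 2 a b y → IsOfHodgeType 4 X 2 a b (t y)) ∧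
        (∃ Z ∈ algebraicClasses (X ⊗ X) 4, ∀ y : complexBetti X 2,
          t y = corrAction complexOrientationFamily hX hX (rfl : 2 + 2 * 4 = 2 + 2 * 4) Z y) ∧
        ∃ ev : ℂ, t (φ.symm z) = ev • φ.symm z ∧ ∀ a : ℚ, (a : ℂ) ≠ ev) :
    Summit.HodgeConjecture.HodgeConjecture.Theses.MarkmanPartnerTransport.LowPicardRealMultiplication := by
  intro X hX hK φ P z hM hsp hρ
  obtain ⟨hprime, t, ht_rat, ht_typ, ht_cyc, ev, ht_ev, hev⟩ := hOne X hX hK φ P z hM hsp hρ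
  rcases generatedBy_or_cm_of_eigenvalue hX hM hprime t ht_rat ht_typ ht_ev hev with
    hgen | ⟨-, Ψ, hΨrat, hΨ11, μ, hμ, hΨσ⟩
  · exact hodgeConjectureFor_of_cycleInducedGenerator hV hO hQ hX hK hM t ht_rat ht_typ ht_cyc hgen
  · exact absurd (spannedByIsometries_of_cm hX hM Ψ hΨrat hΨ11 hΨσ hμ) hsp

/-- **`LowPicardRealMultiplication` BY NAME from the one-cycle clause (degree form), from the route's published
facts**: `QInvAlgebraic` supplied by Charles–Markman 2013 + Verbitsky–Guan (`qInvAlgebraic_of_charlesMarkman`):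
modulo {Verbitsky–Guan, O'Grady, Charles–Markman}. CONDITIONAL; credits nothing; the crux stays open (needed:
the one algebraic class acting on the symplectic form by a generator of the RM field).
[cite: CharlesMarkman2013, Thm. 1.1 (§1)] [cite: Markman2024, §1.1 Thm. 1.1] [cite: Varesco2023, §2 (p. 8)] -/
theorem lowPicardRealMultiplication_of_oneCycleFifth_of_charlesMarkman
    (hV : VerbitskyGuan_cohomology_K3HilbertSquareType) (hO : OGrady2008_dualBBFClass_algebraic)
    (hB : CharlesMarkman2013_lefschetzStandard_K3HilbertType)
    (hOne : ∀ (X : SchemeOver ℂ) (hX : IsSmoothProjective 4 X), IsOfK3HilbertSquareType X →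
      ∀ (φ : complexBetti X 2 ≃ₗ[ℂ] (K3HilbertIndex → ℂ)) (P : complexBetti X (2 * 4)) (z : K3HilbertIndex → ℂ),
      MarkedK3Sq[X, φ, P, z] → ¬ SpIso[X, φ] → Module.finrank ℂ ↥(algebraicClasses X 1) ≤ 3 →
      ∃ (k : ℕ) (t : complexBetti X 2 →ₗ[ℂ] complexBetti X 2),
        (∀ j m : ℕ, 2 ≤ j → 3 ≤ m → k * j * m + Module.finrank ℂ ↥(algebraicClasses X 1) ≠ 23) ∧
        (∀ y, IsRationalClass y → IsRationalClass (t y)) ∧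
        (∀ (a b : ℕ) y, IsOfHodgeType 4 X 2 a b y → IsOfHodgeType 4 X 2 a b (t y)) ∧
        (∃ Z ∈ algebraicClasses (X ⊗ X) 4, ∀ y : complexBetti X 2,
          t y = corrAction complexOrientationFamily hX hX (rfl : 2 + 2 * 4 = 2 + 2 * 4) Z y) ∧
        ∃ ev : ℂ, t (φ.symm z) = ev • φ.symm z ∧ (minpoly ℚ ev).natDegree = k) :
    Summit.HodgeConjecture.HodgeConjecture.Theses.MarkmanPartnerTransport.LowPicardRealMultiplication :=
  lowPicardRealMultiplication_of_oneCycleFifth hV hO (qInvAlgebraic_of_charlesMarkman hV hB) hOne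

/-! ### One cycle suffices at every Picard rank, the CM alternative absorbed by `IsometrySpannedThird` -/

/-- **One cycle suffices on the `X` side, with no CM clause**: for a marked smooth projective `K3^{[2]}`-type `X`
with the arithmetic side condition (`d · m + ρ(X) = 23 ⇒ d` prime; automatic at `ρ(X) ∈ {1, 2}`), ONE algebraic
class `Z ∈ A⁴(X × X)` acting on `H²(X)` rationally and type-preservingly with an IRRATIONAL eigenvalue on the
symplectic form gives HC⁴(X) — granted item #3 `IsometrySpannedThird` (which absorbs the CM alternative through
`spannedByIsometries_of_cm`) and modulo {Verbitsky–Guan, O'Grady, `QInvAlgebraic`}.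
[cite: Markman2024, §1.1 Thm. 1.1] [cite: Varesco2023, §2 (p. 8)] [cite: Zarhin1983HodgeGroupsK3, Thm. 1.5.1 and Thm. 1.6] -/
theorem hodgeConjectureFor_of_oneCycle_of_isometrySpannedThird
    (hV : VerbitskyGuan_cohomology_K3HilbertSquareType) (hO : OGrady2008_dualBBFClass_algebraic) (hQ : QInvAlgebraic)
    (hIS : Summit.HodgeConjecture.HodgeConjecture.Theses.MarkmanPartnerTransport.IsometrySpannedThird)
    {X : SchemeOver ℂ} (hX : IsSmoothProjective 4 X) (hK : IsOfK3HilbertSquareType X)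
    {φ : complexBetti X 2 ≃ₗ[ℂ] (K3HilbertIndex → ℂ)} {P : complexBetti X (2 * 4)} {z : K3HilbertIndex → ℂ}
    (hM : MarkedK3Sq[X, φ, P, z])
    (hρ : ∀ d m : ℕ, 2 ≤ d → 3 ≤ m → d * m + Module.finrank ℂ ↥(algebraicClasses X 1) = 23 → d.Prime)
    (t : complexBetti X 2 →ₗ[ℂ] complexBetti X 2) (ht_rat : ∀ y, IsRationalClass y → IsRationalClass (t y))
    (ht_typ : ∀ (a b : ℕ) y, IsOfHodgeType 4 X 2 a b y → IsOfHodgeType 4 X 2 a b (t y))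
    (ht_cyc : ∃ Z ∈ algebraicClasses (X ⊗ X) 4, ∀ y : complexBetti X 2,
      t y = corrAction complexOrientationFamily hX hX (rfl : 2 + 2 * 4 = 2 + 2 * 4) Z y)
    {ev : ℂ} (ht_ev : t (φ.symm z) = ev • φ.symm z) (hev : ∀ a : ℚ, (a : ℂ) ≠ ev) :
    HodgeConjectureFor 4 X := by
  rcases generatedBy_or_cm_of_eigenvalue hX hM hρ t ht_rat ht_typ ht_ev hev with
    hgen | ⟨-, Ψ, hΨrat, hΨ11, μ, hμ, hΨσ⟩
  · exact hodgeConjectureFor_of_cycleInducedGenerator hV hO hQ hX hK hM t ht_rat ht_typ ht_cyc hgen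
  · exact hIS X hX hK φ P z hM (spannedByIsometries_of_cm hX hM Ψ hΨrat hΨ11 hΨσ hμ)

/-- **One cycle suffices on the `X` side, from FOUR published facts** {Verbitsky–Guan, O'Grady, Charles–Markman
2013, Markman 2024}: `IsometrySpannedThird` is the tree's `isometrySpannedThird_of_three_facts` and
`QInvAlgebraic` is `qInvAlgebraic_of_charlesMarkman`. At `ρ(X) ∈ {1, 2}` the arithmetic side condition is
automatic (`prime_of_mul_eq_twentyTwo`, `prime_of_mul_eq_twentyOne` of `…K3Sq2OneCycleHodge`). CONDITIONAL;
credits nothing. [cite: CharlesMarkman2013, Thm. 1.1 (§1)] [cite: Markman2024, §1.1 Thm. 1.1]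
[cite: Varesco2023, §2 (p. 8)] -/
theorem hodgeConjectureFor_of_oneCycle_of_four_facts
    (hV : VerbitskyGuan_cohomology_K3HilbertSquareType) (hO : OGrady2008_dualBBFClass_algebraic)
    (hB : CharlesMarkman2013_lefschetzStandard_K3HilbertType) (hMk : Markman2024_rationalHodgeIsometry_algebraic_marked)
    {X : SchemeOver ℂ} (hX : IsSmoothProjective 4 X) (hK : IsOfK3HilbertSquareType X)
    {φ : complexBetti X 2 ≃ₗ[ℂ] (K3HilbertIndex → ℂ)} {P : complexBetti X (2 * 4)} {z : K3HilbertIndex → ℂ}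
    (hM : MarkedK3Sq[X, φ, P, z])
    (hρ : ∀ d m : ℕ, 2 ≤ d → 3 ≤ m → d * m + Module.finrank ℂ ↥(algebraicClasses X 1) = 23 → d.Prime)
    (t : complexBetti X 2 →ₗ[ℂ] complexBetti X 2) (ht_rat : ∀ y, IsRationalClass y → IsRationalClass (t y))
    (ht_typ : ∀ (a b : ℕ) y, IsOfHodgeType 4 X 2 a b y → IsOfHodgeType 4 X 2 a b (t y))
    (ht_cyc : ∃ Z ∈ algebraicClasses (X ⊗ X) 4, ∀ y : complexBetti X 2,
      t y = corrAction complexOrientationFamily hX hX (rfl : 2 + 2 * 4 = 2 + 2 * 4) Z y)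
    {ev : ℂ} (ht_ev : t (φ.symm z) = ev • φ.symm z) (hev : ∀ a : ℚ, (a : ℂ) ≠ ev) :
    HodgeConjectureFor 4 X :=
  hodgeConjectureFor_of_oneCycle_of_isometrySpannedThird hV hO (qInvAlgebraic_of_charlesMarkman hV hB)
    (isometrySpannedThird_of_three_facts hV hB hMk) hX hK hM hρ t ht_rat ht_typ ht_cyc ht_ev hev

/-! ### Degree forms of the no-CM-clause theorems (appended) -/

/-- **One cycle suffices on the `X` side, degree form, no CM clause**: as
`hodgeConjectureFor_of_oneCycle_of_isometrySpannedThird`, with the eigenvalue `ev` algebraic of degree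
`k = deg minpoly_ℚ(ev)` and `k · j · m + ρ(X) ≠ 23` for `j ≥ 2`, `m ≥ 3` (covers `ρ(X) = 3`, `[E:ℚ] = 4` with an
eigenvalue of degree `4`) — granted `IsometrySpannedThird`, modulo {Verbitsky–Guan, O'Grady, `QInvAlgebraic`}.
[cite: Markman2024, §1.1 Thm. 1.1] [cite: Varesco2023, §2 (p. 8)] [cite: Vangeemen2008, Lemma 3.2] -/
theorem hodgeConjectureFor_of_oneCycle_natDegree_of_isometrySpannedThird
    (hV : VerbitskyGuan_cohomology_K3HilbertSquareType) (hO : OGrady2008_dualBBFClass_algebraic) (hQ : QInvAlgebraic)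
    (hIS : Summit.HodgeConjecture.HodgeConjecture.Theses.MarkmanPartnerTransport.IsometrySpannedThird)
    {X : SchemeOver ℂ} (hX : IsSmoothProjective 4 X) (hK : IsOfK3HilbertSquareType X)
    {φ : complexBetti X 2 ≃ₗ[ℂ] (K3HilbertIndex → ℂ)} {P : complexBetti X (2 * 4)} {z : K3HilbertIndex → ℂ}
    (hM : MarkedK3Sq[X, φ, P, z]) {k : ℕ}
    (hk : ∀ j m : ℕ, 2 ≤ j → 3 ≤ m → k * j * m + Module.finrank ℂ ↥(algebraicClasses X 1) ≠ 23)
    (t : complexBetti X 2 →ₗ[ℂ] complexBetti X 2) (ht_rat : ∀ y, IsRationalClass y → IsRationalClass (t y))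
    (ht_typ : ∀ (a b : ℕ) y, IsOfHodgeType 4 X 2 a b y → IsOfHodgeType 4 X 2 a b (t y))
    (ht_cyc : ∃ Z ∈ algebraicClasses (X ⊗ X) 4, ∀ y : complexBetti X 2,
      t y = corrAction complexOrientationFamily hX hX (rfl : 2 + 2 * 4 = 2 + 2 * 4) Z y)
    {ev : ℂ} (ht_ev : t (φ.symm z) = ev • φ.symm z) (hdeg : (minpoly ℚ ev).natDegree = k) :
    HodgeConjectureFor 4 X := by
  rcases generatedBy_or_cm_of_eigenvalue_natDegree hX hM hk t ht_rat ht_typ ht_ev hdeg with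
    hgen | ⟨-, Ψ, hΨrat, hΨ11, μ, hμ, hΨσ⟩
  · exact hodgeConjectureFor_of_cycleInducedGenerator hV hO hQ hX hK hM t ht_rat ht_typ ht_cyc hgen
  · exact hIS X hX hK φ P z hM (spannedByIsometries_of_cm hX hM Ψ hΨrat hΨ11 hΨσ hμ)

/-- **One cycle suffices on the `X` side, degree form, from FOUR published facts** {Verbitsky–Guan, O'Grady,
Charles–Markman 2013, Markman 2024}. CONDITIONAL; credits nothing. [cite: CharlesMarkman2013, Thm. 1.1 (§1)]
[cite: Markman2024, §1.1 Thm. 1.1] [cite: Varesco2023, §2 (p. 8)] -/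
theorem hodgeConjectureFor_of_oneCycle_natDegree_of_four_facts
    (hV : VerbitskyGuan_cohomology_K3HilbertSquareType) (hO : OGrady2008_dualBBFClass_algebraic)
    (hB : CharlesMarkman2013_lefschetzStandard_K3HilbertType) (hMk : Markman2024_rationalHodgeIsometry_algebraic_marked)
    {X : SchemeOver ℂ} (hX : IsSmoothProjective 4 X) (hK : IsOfK3HilbertSquareType X)
    {φ : complexBetti X 2 ≃ₗ[ℂ] (K3HilbertIndex → ℂ)} {P : complexBetti X (2 * 4)} {z : K3HilbertIndex → ℂ}
    (hM : MarkedK3Sq[X, φ, P, z]) {k : ℕ}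
    (hk : ∀ j m : ℕ, 2 ≤ j → 3 ≤ m → k * j * m + Module.finrank ℂ ↥(algebraicClasses X 1) ≠ 23)
    (t : complexBetti X 2 →ₗ[ℂ] complexBetti X 2) (ht_rat : ∀ y, IsRationalClass y → IsRationalClass (t y))
    (ht_typ : ∀ (a b : ℕ) y, IsOfHodgeType 4 X 2 a b y → IsOfHodgeType 4 X 2 a b (t y))
    (ht_cyc : ∃ Z ∈ algebraicClasses (X ⊗ X) 4, ∀ y : complexBetti X 2,
      t y = corrAction complexOrientationFamily hX hX (rfl : 2 + 2 * 4 = 2 + 2 * 4) Z y)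
    {ev : ℂ} (ht_ev : t (φ.symm z) = ev • φ.symm z) (hdeg : (minpoly ℚ ev).natDegree = k) :
    HodgeConjectureFor 4 X :=
  hodgeConjectureFor_of_oneCycle_natDegree_of_isometrySpannedThird hV hO (qInvAlgebraic_of_charlesMarkman hV hB)
    (isometrySpannedThird_of_three_facts hV hB hMk) hX hK hM hk t ht_rat ht_typ ht_cyc ht_ev hdeg

end Summit.HodgeConjecture.HodgeConjecture.Theorems.MarkmanPartnerTransport.PartnerLattice

end
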